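import Literature.AlgebraicGeometry.Resolution.LinearProjectionVertex
import Literature.AlgebraicGeometry.Resolution.LinearSectionsChoice
import Literature.AlgebraicGeometry.Motives.VarietiesProjectiveSpaceProofs
import Literature.AlgebraicGeometry.Motives.VarietiesProperProofs
import Mathlib.AlgebraicGeometry.Morphisms.ClosedImmersion
import Mathlib.AlgebraicGeometry.Noetherian

/-!
# `WeightedInvariant.WeightedThesis`, line `datum-glued-split`, stub 5a-F3:
# generic linear forms without common zero

Crux `WeightedThesis` (stmt-ResolutionOfSingularities-0569), stub
`stub_genericFormsNoCommonZero` of the lead's assembly `stub_hypersurfaceModel_infinite`.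
PROVED here, for an integral closed `X ⊆ ℙⁿ_k` of dimension `d` over an INFINITE field `k` and
any family of generic side conditions `P j a` on the `j`-th form given the first `j` ones:
there are linear forms `t₀, …, t_{d+1}` satisfying all the `P j`, with `t₀, …, t_d` without
common zero on `X` and `t₀ ≢ 0` on `X`.

Proof (the bookkeeping (C1) of the tree's `LinSec.exists_goodForms`, which is stated over
algebraically closed fields only because of its Bertini clauses): run
`exists_seq_of_isGeneric` with `P` strengthened by "`t_j` misses the component generic points
of `X ∩ V(t₀, …, t_{j-1})`" (`LinSec.isGeneric_avoid_genPts`) and "`t_j` misses the generic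
point of `X`" (`LinSec.isGeneric_notMem_hyp`); the dimension then drops at each cut
(`LinSec.cutOf_eq_empty`, `dim X < d + 1`), and `η_X ∉ V(t₀)` gives `formFn ι t₀ ≠ 0`
(`LinSec.isUnitAt_formFn_div_iff` at the generic point).

## References

* R. Hartshorne, *Algebraic Geometry* (1977), I Prop. 7.1, II Thm. 8.18 (proof). [Hartshorne1977]
* A. J. de Jong, *Smoothness, semi-stability and alterations*, Publ. Math. IHÉS 83 (1996), 2.11.
  [DeJong1996]
-/

noncomputable section

set_option linter.dupNamespace false -- mandated namespace of this single-conjunct summit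

open CategoryTheory AlgebraicGeometry TopologicalSpace Topology
open Literature.AlgebraicGeometry.Resolution Literature.AlgebraicGeometry.Motives
open Literature.AlgebraicGeometry.Motives.RatFn

namespace Summit.ResolutionOfSingularities.ResolutionOfSingularities.Theorems.WeightedThesis.HypersurfaceModel

universe u

/-- **Generic linear forms without common zero** (tree spelling `ι : X ⟶ 𝐏ⁿ_k`): for an integral
closed `X ⊆ ℙⁿ_k` of dimension `d` over an infinite field `k`, and conditions `P j a` on the next
form which are generic for every choice `a` of the first `j` forms, there are linear forms
`t₀, …, t_{d+1}` with `P j (t₀, …, t_{j-1}) t_j` for all `j ≤ d + 1`, such that `t₀, …, t_d`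
have no common zero on `X` and the rational function of `t₀` on `X` is non-zero.
[cite: Hartshorne1977, I Prop. 7.1 and II Thm. 8.18 (proof)] [cite: DeJong1996, 2.11] -/
theorem genericFormsNoCommonZero {k : Type u} [Field k] [Infinite k] (n : ℕ) {X : Scheme.{u}}
    [IsIntegral X] (ι : X ⟶ Literature.AlgebraicGeometry.Morphisms.ProjCech.PP k n)
    [IsClosedImmersion ι] (d : ℕ) (hdim : topologicalKrullDim X = d)
    (P : ∀ j : ℕ, (Fin j → Fin (n + 1) → k) → (Fin (n + 1) → k) → Prop)
    (hP : ∀ (j : ℕ) (a : Fin j → Fin (n + 1) → k), IsGeneric (P j a)) :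
    ∃ t : Fin (d + 1 + 1) → Fin (n + 1) → k,
      (∀ (j : ℕ) (hj : j < d + 1 + 1), P j (Fin.take j hj.le t) (t ⟨j, hj⟩)) ∧
        LinSec.NoCommonZero ι (LinSec.tInit t) ∧ LinSec.formFn ι (t 0) ≠ 0 := by
  classical
  -- adapted from Literature/AlgebraicGeometry/Resolution/LinearProjectionChoice.lean (C1)
  -- instances: `X` is a Noetherian space (closed in `ℙⁿ_k`, Noetherian since proper over `k`)
  haveI : IsProper (projectiveSpace n k).hom := isProper_projectiveSpace n k
  haveI : IsLocallyNoetherian (projectiveSpace n k).left :=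
    LocallyOfFiniteType.isLocallyNoetherian (projectiveSpace n k).hom
  haveI : CompactSpace (projectiveSpace n k).left :=
    QuasiCompact.compactSpace_of_compactSpace (projectiveSpace n k).hom
  haveI : IsNoetherian (projectiveSpace n k).left := {}
  haveI : NoetherianSpace (Literature.AlgebraicGeometry.Morphisms.ProjCech.PP k n) :=
    inferInstanceAs (NoetherianSpace (projectiveSpace n k).left)
  haveI : NoetherianSpace X := ι.isEmbedding.isInducing.noetherianSpace
  -- the strengthened generic conditions
  let P' : ∀ j : ℕ, (Fin j → Fin (n + 1) → k) → (Fin (n + 1) → k) → Prop := fun j a b =>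
    P j a b ∧ (∀ w ∈ LinSec.genPts (Set.univ ∩ LinSec.cutSet ι a), w ∉ LinSec.hyp ι b) ∧
      genericPoint X ∉ LinSec.hyp ι b
  have hP' : ∀ j a, IsGeneric (P' j a) := fun j a =>
    (hP j a).and ((LinSec.isGeneric_avoid_genPts ι _).and
      (LinSec.isGeneric_notMem_hyp ι (genericPoint X)))
  obtain ⟨t, ht⟩ := exists_seq_of_isGeneric P' hP' (d + 1 + 1)
  refine ⟨t, fun j hj => (ht j hj).1, ?_, ?_⟩
  · -- `t₀, …, t_d` have no common zero: the dimension drops at each cut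
    have hXd : ∀ (j : ℕ) (hj : j < d + 1 + 1),
        ∀ w ∈ LinSec.genPts (LinSec.cutOf ι Set.univ t j hj.le), w ∉ LinSec.hyp ι (t ⟨j, hj⟩) :=
      fun j hj => (ht j hj).2.1
    have hdimX : topologicalKrullDim ↥(Set.univ : Set X) < (d + 1 : ℕ) := by
      rw [IsHomeomorph.topologicalKrullDim_eq _ (Homeomorph.Set.univ X).isHomeomorph, hdim]
      exact_mod_cast Nat.lt_succ_self _
    rw [LinSec.noCommonZero_iff_cutSet_eq_empty]
    have h := LinSec.cutOf_eq_empty ι isClosed_univ t hXd d hdimX (Nat.le_succ _)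
    rwa [LinSec.cutOf, Set.univ_inter] at h
  · -- `t₀ ≢ 0`: `η_X ∉ V(t₀)`, so `t₀/x_{j₀}` is a unit at `η_X`
    have h0 : genericPoint X ∉ LinSec.hyp ι (t 0) := (ht 0 (Nat.zero_lt_succ _)).2.2
    have hu := (LinSec.isUnitAt_formFn_div_iff ι (LinSec.genericPoint_mem_chart_j₀ ι) (t 0)).mpr h0
    intro h
    apply hu.ne_zero
    rw [h, zero_div]

/-- **S5a-F3 (PROVED) — generic linear forms without common zero**, in the registered shape:
for an integral closed `X ⊆ ℙⁿ_k` of dimension `d` over an infinite field `k`, and conditions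
`P j a` on the next form which are generic for every choice `a` of the first `j` forms, there are
linear forms `t₀, …, t_{d+1}` with `P j (t₀, …, t_{j-1}) t_j` for all `j ≤ d + 1`, such that
`t₀, …, t_d` have no common zero on `X` and the rational function of `t₀` on `X` is non-zero
(`genericFormsNoCommonZero`).
[cite: Hartshorne1977, I Prop. 7.1 and II Thm. 8.18 (proof)] [cite: DeJong1996, 2.11] -/
theorem stub_genericFormsNoCommonZero : ∀ (k : Type) [Field k] [Infinite k] (n : ℕ) (X : AlgebraicGeometry.Scheme.{0}) [AlgebraicGeometry.IsIntegral X] (ι : X ⟶ (Literature.AlgebraicGeometry.Motives.projectiveSpace n k).left) [AlgebraicGeometry.IsClosedImmersion ι] (d : ℕ), topologicalKrullDim X = d → ∀ (P : ∀ j : ℕ, (Fin j → Fin (n + 1) → k) → (Fin (n + 1) → k) → Prop), (∀ (j : ℕ) (a : Fin j → Fin (n + 1) → k), Literature.AlgebraicGeometry.Resolution.IsGeneric (P j a)) → ∃ t : Fin (d + 1 + 1) → Fin (n + 1) → k, (∀ (j : ℕ) (hj : j < d + 1 + 1), P j (Fin.take j hj.le t) (t ⟨j, hj⟩)) ∧ Literature.AlgebraicGeometry.Resolution.LinSec.NoCommonZero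 ι (Literature.AlgebraicGeometry.Resolution.LinSec.tInit t) ∧ Literature.AlgebraicGeometry.Resolution.LinSec.formFn ι (t 0) ≠ 0 := by
  intro k _ _ n X hX ι hι d hdim P hP
  exact @genericFormsNoCommonZero k _ _ n X hX ι hι d hdim P hP

end Summit.ResolutionOfSingularities.ResolutionOfSingularities.Theorems.WeightedThesis.HypersurfaceModel

end
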